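import Summits.QuantumFields.BalabanUV.T4Continuum.Spine.NE1p.B7AveragingLevelsPlaqLocal

/-!
# T⁴ programme, spine estimate NE1′ (node O3b/H2) — PROP. 4's BOOKKEEPING (136) FOR THE CURVATURE CHAIN: the quadratic term of the printed
# `Q_j(U₀, τA)(c)` in the slot amplitude IS the quadratic term of the printed REMAINDER `C_j(U₀, τA)(c)` (136) (the linear part `LʲQ_j(U₀)A`
# is homogeneous in `τ`), so every bound of files 19–22 is a bound on `∂_τ²|₀ C_j(U₀, τA)(c)`

Cell `pub-balaban-gaps` (YM blitz Y1, track G2), seat `ne1` gen 11 session 3 (prover-pub-balaban-gaps-ne1-g11-0); record `HOME/ne/NE1.md`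
§4 R69.  ADDITIVE — imports this seat's file 22 `B7AveragingLevelsPlaqLocal` (through it files 18–21: `analyticAt_logCovIter_slot`,
`norm_levels_curvature_sub_le`, `norm_levels_curvature_le_of_plaq_oneSite`, `logCovIter_slot_congr`) and uses the p06 lineage's
`B7Prop4GeneralCk.linCovIter_csmul` («LʲQ_j(U₀)(cA) = c·LʲQ_j(U₀)A» in the regime), `B7Prop5GeneralInduction.CCovIter` (= the printed
remainder `C_j(U₀, B)(c) := Q_j(U₀, B)(c) − (LʲQ_j(U₀)B)(c)`, (136)) and `B7Eq136SecondOrder.CCovIter2` (the printed second-order term `C_j⁽²⁾`,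
(136) ∕ [B9] (3.127)) BY NAME; nothing edited or restated; 0 def.

PRINT.  [Balaban1985Averaging] (133)–(136) p. 38–39: «Q_j(U₀, ηA) = LʲηQ_j(U₀)A + C_j(U₀, ηA)», `C_j` analytic with Taylor expansion beginning
at second order; Proposition 7 p. 43.  The curvature chain (files 8–22) bounds `∂_τ²|₀ Q_j(U₀, τA)(c)`; print's object carrying the
second-order information is `C_j` — THIS file identifies the two quadratic terms at every background of the regime.

WHAT THIS FILE PROVES ([folklore] calculus on the lineage's kernel theorems; 0 sorry):
* `iteratedDeriv_two_linCovIter_smul` — at a `G`-valued background with (52), `j ≤ k`: `∂_τ²|₀ (LʲQ_j(U₀)(τA))(c) = 0` (homogeneity,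
  `linCovIter_csmul`); `analyticAt_linCovIter_smul`.
* **`iteratedDeriv_two_CCovIter_eq`** — if moreover `τ ↦ Q_j(U₀, τA)(c)` is analytic at `0` (Prop. 7): `∂_τ²|₀ C_j(U₀, τA)(c) = ∂_τ²|₀ Q_j(U₀, τA)(c)`;
  **`CCovIter2_eq_half_iteratedDeriv_two_logCovIter`** — the lineage's printed second-order term `C_j⁽²⁾(U₀, A)(c)` (136)
  (`B7Eq136SecondOrder.CCovIter2`) is `½·∂_τ²|₀ Q_j(U₀, τA)(c)`.
* **`norm_remainder_curvature_sub_le`** — file 19's Lipschitz bound read on the remainder at the base point: under the Prop.-7 regime data,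
  `sup‖A‖ ≤ a`, `sup‖B‖ ≤ b`, `2b ≤ β′`: `‖∂_τ²|₀ Q_j(e^{B}U₀, τA)(c) − ∂_τ²|₀ C_j(U₀, τA)(c)‖ ≤ 8·Lʲ·a²·b∕(β·β′)`.
* **`norm_remainder_curvature_le_of_plaq_oneSite`** — file 22's generator-free local bound read on the remainder: for a `G`-valued `U₀` with
  (52) (globally, for the identification; and on the block pair) whose unit plaquettes inside `B^j(c₋) ∪ B^j(c₊)` are within `α` of `1`, and a
  one-site commuting slot with `sup‖A‖ ≤ a`: `‖∂_τ²|₀ C_j(U₀, τA)(c)‖ ≤ 8·Lʲ·a²·((4dLʲ+1)·α)∕(β·β′)`;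
  **`norm_CCovIter2_le_of_plaq_oneSite`** — the same for the printed object: `‖C_j⁽²⁾(U₀, A)(c)‖ ≤ 4·Lʲ·a²·((4dLʲ+1)·α)∕(β·β′)`.
What it does NOT do: the remainder's own recursion (137)–(140) with honest constants; NODE O.

HONEST FRAMING.  [folklore] calculus over the lineages' verbatim ℤᵈ model of [B7] and their kernel Propositions 4∕7; nothing of Bałaban's
asserted beyond print; NE1′ NOT proved; spine 0∕9; (B) 0∕13; binders 0∕6; one finite T⁴ — NOT ℝ⁴, NOT infinite volume, NOT a mass gap, NOT Clay.
-/

noncomputable section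

open scoped Topology
open NormedSpace Filter Metric Set

namespace Summit.QuantumFields.BalabanUV.T4Continuum.NE1p.B7AveragingCommutator

open Literature.MathematicalPhysics.QuantumFieldTheory.Balaban1983to89.B7Prop1Explicit
open Literature.MathematicalPhysics.QuantumFieldTheory.Balaban1983to89.B7Prop1Local (InBox PlaqIn loK bondHiK pdevOn)
open Literature.MathematicalPhysics.QuantumFieldTheory.Balaban1983to89.B7Prop2Explicit (avgIter pdev C0 c2' AvgClosed)
open Literature.MathematicalPhysics.QuantumFieldTheory.Balaban1983to89.B7Prop3Flat (expCfg c3)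
open Literature.MathematicalPhysics.QuantumFieldTheory.Balaban1983to89.B7Prop3GeneralRotated (expCfg_zero)
open Literature.MathematicalPhysics.QuantumFieldTheory.Balaban1983to89.B7Prop4GeneralLevels (logCovIter linCovIter)
open Literature.MathematicalPhysics.QuantumFieldTheory.Balaban1983to89.B7Prop4GeneralCk (linCovIter_csmul)
open Literature.MathematicalPhysics.QuantumFieldTheory.Balaban1983to89.B7Prop5GeneralInduction (CCovIter)
open Literature.MathematicalPhysics.QuantumFieldTheory.Balaban1983to89.B7Eq136SecondOrder (CCovIter2 CCovIter2_def)

variable {d : ℕ} {𝔸 : Type*} [NormedRing 𝔸] [NormedAlgebra ℂ 𝔸] [CompleteSpace 𝔸] [NormOneClass 𝔸]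

section Remainder

variable (L : ℕ) (hL : 2 ≤ L) {G : Subgroup 𝔸ˣ} (hG : AvgClosed d L G) (k : ℕ) {α₀ : ℝ} (hα : 0 < α₀)
  (hα3 : C0 d * α₀ ≤ 1 / 3) (hα8 : 8 * α₀ ≤ c2' d L)
  (U₀ : Site d → Fin d → 𝔸ˣ) (hU₀ : ∀ x μ, U₀ x μ ∈ G) (h52 : pdev U₀ < α₀ * (((L : ℝ) ^ k)⁻¹) ^ 2)

include hL hG hα hα3 hα8 hU₀ h52 in
/-- **The linear part is homogeneous along the slot ray**: `(LʲQ_j(U₀)(τA))(c) = τ·(LʲQ_j(U₀)A)(c)` (`linCovIter_csmul`), hence its second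
`τ`-derivative at `0` vanishes, `j ≤ k`. [cite: Balaban1985Averaging, (133) p.38, (122) p.36] -/
theorem iteratedDeriv_two_linCovIter_smul (A : Site d → Fin d → 𝔸) {j : ℕ} (hj : j ≤ k) (z : Site d) (κ : Fin d) :
    iteratedDeriv 2 (fun τ : ℂ => linCovIter L U₀ (τ • A) j z κ) 0 = 0 := by
  have hα4 : 4 * α₀ ≤ c2' d L := by linarith
  have hlin : (fun τ : ℂ => linCovIter L U₀ (τ • A) j z κ) = fun τ : ℂ => τ • linCovIter L U₀ A j z κ := by
    funext τ; rw [linCovIter_csmul L hL hG k U₀ hU₀ hα hα3 hα4 h52 τ A j hj]; rfl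
  rw [hlin, iteratedDeriv_succ, iteratedDeriv_one]
  have hd : deriv (fun τ : ℂ => τ • linCovIter L U₀ A j z κ) = fun _ => linCovIter L U₀ A j z κ := by
    funext τ
    exact ((hasDerivAt_id τ).smul_const _).deriv.trans (by simp)
  rw [hd, deriv_const]

include hL hG hα hα3 hα8 hU₀ h52 in
/-- The linear part along the slot ray is analytic (it is `τ ↦ τ·const`). [cite: Balaban1985Averaging, (133) p.38] -/
theorem analyticAt_linCovIter_smul (A : Site d → Fin d → 𝔸) {j : ℕ} (hj : j ≤ k) (z : Site d) (κ : Fin d) (τ₀ : ℂ) :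
    AnalyticAt ℂ (fun τ : ℂ => linCovIter L U₀ (τ • A) j z κ) τ₀ := by
  have hα4 : 4 * α₀ ≤ c2' d L := by linarith
  have hlin : (fun τ : ℂ => linCovIter L U₀ (τ • A) j z κ) = fun τ : ℂ => τ • linCovIter L U₀ A j z κ := by
    funext τ; rw [linCovIter_csmul L hL hG k U₀ hU₀ hα hα3 hα4 h52 τ A j hj]; rfl
  rw [hlin]; exact analyticAt_id.smul analyticAt_const

include hL hG hα hα3 hα8 hU₀ h52 in
/-- **THE QUADRATIC TERM OF `Q_j` IS THE QUADRATIC TERM OF THE PRINTED REMAINDER `C_j` (136)**: at a background of the regime, for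
`τ ↦ Q_j(U₀, τA)(c)` analytic at `0`, `∂_τ²|₀ C_j(U₀, τA)(c) = ∂_τ²|₀ Q_j(U₀, τA)(c)`, `j ≤ k`.
[cite: Balaban1985Averaging, (133)–(136) pp.38–39] -/
theorem iteratedDeriv_two_CCovIter_eq (A : Site d → Fin d → 𝔸) {j : ℕ} (hj : j ≤ k) (z : Site d) (κ : Fin d)
    (hQ : AnalyticAt ℂ (fun τ : ℂ => logCovIter L U₀ (τ • A) j z κ) 0) :
    iteratedDeriv 2 (fun τ : ℂ => CCovIter L U₀ (τ • A) j z κ) 0 = iteratedDeriv 2 (fun τ : ℂ => logCovIter L U₀ (τ • A) j z κ) 0 := by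
  have hC : (fun τ : ℂ => CCovIter L U₀ (τ • A) j z κ)
      = (fun τ : ℂ => logCovIter L U₀ (τ • A) j z κ) - fun τ : ℂ => linCovIter L U₀ (τ • A) j z κ := by
    funext τ; rfl
  rw [hC, iteratedDeriv_sub (hQ.contDiffAt.of_le le_top)
    ((analyticAt_linCovIter_smul L hL hG k hα hα3 hα8 U₀ hU₀ h52 A hj z κ 0).contDiffAt.of_le le_top),
    iteratedDeriv_two_linCovIter_smul L hL hG k hα hα3 hα8 U₀ hU₀ h52 A hj z κ, sub_zero]

include hL hG hα hα3 hα8 hU₀ h52 in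
/-- **THE LINEAGE's PRINTED SECOND-ORDER TERM `C_j⁽²⁾(U₀, A)(c)` (136)** (`B7Eq136SecondOrder.CCovIter2`, the `t²`-coefficient of the slice
`t ↦ C_j(U₀, tA)(c)`) **IS HALF THE CHAIN's QUADRATIC TERM**: `C_j⁽²⁾(U₀, A)(c) = ½·∂_τ²|₀ Q_j(U₀, τA)(c)` at a background of the regime, for
`τ ↦ Q_j(U₀, τA)(c)` analytic at `0`. [cite: Balaban1985Averaging, (136)–(137) p.39] -/
theorem CCovIter2_eq_half_iteratedDeriv_two_logCovIter (A : Site d → Fin d → 𝔸) {j : ℕ} (hj : j ≤ k) (z : Site d) (κ : Fin d)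
    (hQ : AnalyticAt ℂ (fun τ : ℂ => logCovIter L U₀ (τ • A) j z κ) 0) :
    CCovIter2 L U₀ A j z κ = (2 : ℂ)⁻¹ • iteratedDeriv 2 (fun τ : ℂ => logCovIter L U₀ (τ • A) j z κ) 0 := by
  rw [CCovIter2_def, iteratedDeriv_two_CCovIter_eq L hL hG k hα hα3 hα8 U₀ hU₀ h52 A hj z κ hQ]

end Remainder

/-! ## The chain's bounds, read on the remainder (136) -/

section Bounds

variable (L : ℕ) (hL : 2 ≤ L) {G : Subgroup 𝔸ˣ} (hG : AvgClosed d L G) (k : ℕ) {α₀ : ℝ} (hα : 0 < α₀)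
  (hα3 : C0 d * α₀ ≤ 1 / 3) (hα8 : 8 * α₀ ≤ c2' d L)
  {β β' : ℝ} (hβ : 0 < β) (hβ' : 0 < β')
  (hsmall' : Real.exp (4 * (800 * ((d : ℝ) + 1) ^ 2 * ((d : ℝ) + 4)) * α₀)
    * (1 + 8 * (131072 * ((d : ℝ) + 1) ^ 2) * ((L : ℝ) ^ k * β')) ≤ 2)
  (hc₃' : 2 * ((L : ℝ) ^ k * β') ≤ c3 d L) (hb'1 : 409600 * ((d : ℝ) + 1) ^ 2 * ((L : ℝ) ^ k * β') ≤ 1)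
  (hsmall : Real.exp (4480 * ((d : ℝ) + 1) ^ 2 * ((d : ℝ) + 4) * α₀ + 240000 * ((d : ℝ) + 1) ^ 3 * ((L : ℝ) ^ k * β'))
    * (1 + 8 * (2097152 * ((d : ℝ) + 1) ^ 2) * ((L : ℝ) ^ k * β)) ≤ 2)
  (hc₃ : 2 * ((L : ℝ) ^ k * β) ≤ c3 d L / 4)
  {A B : Site d → Fin d → 𝔸} {a b : ℝ} (ha0 : 0 < a) (hb0 : 0 < b)
  (ha : ∀ (x : Site d) (μ : Fin d), ‖A x μ‖ ≤ a) (hb : ∀ (x : Site d) (μ : Fin d), ‖B x μ‖ ≤ b)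

include hL hG hα hα3 hα8 hβ hβ' hsmall' hc₃' hb'1 hsmall hc₃ ha0 hb0 ha hb in
/-- **File 19's Lipschitz bound, read on the remainder at the base point**: for a background `U₀` of the regime (`G`-valued, (52)),
`sup‖A‖ ≤ a`, `sup‖B‖ ≤ b`, `2b ≤ β′`, `j ≤ k`:
`‖∂_τ²|₀ Q_j(e^{B}U₀, τA)(c) − ∂_τ²|₀ C_j(U₀, τA)(c)‖ ≤ 8·Lʲ·a²·b∕(β·β′)`.
[cite: Balaban1985Averaging, (136) p.39, Proposition 7 p.43, (131) p.38] -/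
theorem norm_remainder_curvature_sub_le (U₀ : Site d → Fin d → 𝔸ˣ) (hU₀ : ∀ x μ, U₀ x μ ∈ G)
    (h52 : pdev U₀ < α₀ * (((L : ℝ) ^ k)⁻¹) ^ 2) (hbβ : 2 * b ≤ β') {j : ℕ} (hj : j ≤ k) (z : Site d) (κ : Fin d) :
    ‖iteratedDeriv 2 (fun τ : ℂ => logCovIter L (expCfg B * U₀) (τ • A) j z κ) 0
        - iteratedDeriv 2 (fun τ : ℂ => CCovIter L U₀ (τ • A) j z κ) 0‖ ≤ 8 * (L : ℝ) ^ j * a ^ 2 * b / (β * β') := by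
  have hQ : AnalyticAt ℂ (fun τ : ℂ => logCovIter L U₀ (τ • A) j z κ) 0 := by
    have h := analyticAt_logCovIter_slot L hL hG k hα hα3 hα8 hβ hβ' hsmall' hc₃' hb'1 hsmall hc₃ ha hb U₀ hU₀ h52
      (s := 0) (τ₀ := 0) (by rw [norm_zero, zero_mul]; exact hβ'.le) (by rw [norm_zero, zero_mul]; exact hβ.le) hj z κ
    simpa only [zero_smul, expCfg_zero, one_mul] using h
  rw [iteratedDeriv_two_CCovIter_eq L hL hG k hα hα3 hα8 U₀ hU₀ h52 A hj z κ hQ]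
  have h := norm_levels_curvature_sub_le L hL hG k hα hα3 hα8 hβ hβ' hsmall' hc₃' hb'1 hsmall hc₃ ha0 hb0 ha hb U₀ hU₀ h52 hbβ hj z κ
  simpa only [one_smul, zero_smul, expCfg_zero, one_mul] using h

include hL hG hα hα3 hα8 hβ hβ' hsmall' hc₃' hb'1 hsmall hc₃ ha0 ha in
/-- **File 22's generator-free local bound, read on the remainder**: `U₀` `G`-valued with (52) (on `ℤᵈ` — for the identification — hence on
the block pair), unit plaquettes inside `B^j(c₋) ∪ B^j(c₊)` within `α` of `1` (`0 < α`, `2dLʲ·α ≤ 1∕4`, `2·(4dLʲ+1)·α ≤ β′`), a slot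
supported on the bonds at ONE site with commuting values there and `sup‖A‖ ≤ a`; `j ≤ k`:
`‖∂_τ²|₀ C_j(U₀, τA)(c)‖ ≤ 8·Lʲ·a²·((4dLʲ+1)·α)∕(β·β′)`. [cite: Balaban1985Averaging, (136) p.39, (44) p.24, (52) p.26, Proposition 7 p.43] -/
theorem norm_remainder_curvature_le_of_plaq_oneSite (U₀ : Site d → Fin d → 𝔸ˣ) (hU₀ : ∀ x μ, U₀ x μ ∈ G)
    (h52 : pdev U₀ < α₀ * (((L : ℝ) ^ k)⁻¹) ^ 2) {j : ℕ} (hj : j ≤ k) (z : Site d) (κ : Fin d)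
    (h52loc : pdevOn (loK L j z) (bondHiK L j z κ) U₀ < α₀ * (((L : ℝ) ^ k)⁻¹) ^ 2)
    {α : ℝ} (hαp : 0 < α)
    (h44 : ∀ (x : Site d) (μ ν : Fin d), μ ≠ ν → PlaqIn (loK L j z) (bondHiK L j z κ) (x, μ, ν) →
      ‖((hol U₀ x (plaqWord μ ν) : 𝔸ˣ) : 𝔸) - 1‖ ≤ α)
    (hαs : 2 * d * (L : ℝ) ^ j * α ≤ 1 / 4) (hbβ : 2 * ((4 * d * (L : ℝ) ^ j + 1) * α) ≤ β')
    (x₀ : Site d) (hsupp : ∀ (x : Site d) (μ : Fin d), x ≠ x₀ → A x μ = 0) (hcomm : ∀ (μ ν : Fin d), Commute (A x₀ μ) (A x₀ ν)) :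
    ‖iteratedDeriv 2 (fun τ : ℂ => CCovIter L U₀ (τ • A) j z κ) 0‖ ≤ 8 * (L : ℝ) ^ j * a ^ 2 * ((4 * d * (L : ℝ) ^ j + 1) * α) / (β * β') := by
  have hb0' : 0 < β' / 2 := by positivity
  have hB0 : ∀ (x : Site d) (μ : Fin d), ‖(0 : Site d → Fin d → 𝔸) x μ‖ ≤ β' / 2 := fun x μ => by
    rw [Pi.zero_apply, Pi.zero_apply, norm_zero]; exact hb0'.le
  have hQ : AnalyticAt ℂ (fun τ : ℂ => logCovIter L U₀ (τ • A) j z κ) 0 := by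
    have h := analyticAt_logCovIter_slot L hL hG k hα hα3 hα8 hβ hβ' hsmall' hc₃' hb'1 hsmall hc₃ ha hB0 U₀ hU₀ h52
      (s := 0) (τ₀ := 0) (by rw [norm_zero, zero_mul]; exact hβ'.le) (by rw [norm_zero, zero_mul]; exact hβ.le) hj z κ
    simpa only [zero_smul, expCfg_zero, one_mul] using h
  rw [iteratedDeriv_two_CCovIter_eq L hL hG k hα hα3 hα8 U₀ hU₀ h52 A hj z κ hQ]
  exact norm_levels_curvature_le_of_plaq_oneSite L hL hG k hα hα3 hα8 hβ hβ' hsmall' hc₃' hb'1 hsmall hc₃ U₀ hU₀ hj z κ h52loc hαp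
    h44 hαs hbβ ha0 (fun x μ _ _ => ha x μ) x₀ hsupp hcomm

include hL hG hα hα3 hα8 hβ hβ' hsmall' hc₃' hb'1 hsmall hc₃ ha0 ha in
/-- **«DIAGONAL CURVATURE ∝ NON-FLATNESS» FOR THE PRINTED `C_j⁽²⁾` (136)**: under the hypotheses of
`norm_remainder_curvature_le_of_plaq_oneSite`, `‖C_j⁽²⁾(U₀, A)(c)‖ ≤ 4·Lʲ·a²·((4dLʲ+1)·α)∕(β·β′)` — the lineage's own second-order object of
Prop. 4 ∕ [B9] (3.127) at every level, every hypothesis but the regime's (52) on the block pair.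
[cite: Balaban1985Averaging, (136) p.39, (44) p.24, (52) p.26, Proposition 7 p.43] [cite: Balaban1985BackgroundPropagators, (3.127) p.421] -/
theorem norm_CCovIter2_le_of_plaq_oneSite (U₀ : Site d → Fin d → 𝔸ˣ) (hU₀ : ∀ x μ, U₀ x μ ∈ G)
    (h52 : pdev U₀ < α₀ * (((L : ℝ) ^ k)⁻¹) ^ 2) {j : ℕ} (hj : j ≤ k) (z : Site d) (κ : Fin d)
    (h52loc : pdevOn (loK L j z) (bondHiK L j z κ) U₀ < α₀ * (((L : ℝ) ^ k)⁻¹) ^ 2)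
    {α : ℝ} (hαp : 0 < α)
    (h44 : ∀ (x : Site d) (μ ν : Fin d), μ ≠ ν → PlaqIn (loK L j z) (bondHiK L j z κ) (x, μ, ν) →
      ‖((hol U₀ x (plaqWord μ ν) : 𝔸ˣ) : 𝔸) - 1‖ ≤ α)
    (hαs : 2 * d * (L : ℝ) ^ j * α ≤ 1 / 4) (hbβ : 2 * ((4 * d * (L : ℝ) ^ j + 1) * α) ≤ β')
    (x₀ : Site d) (hsupp : ∀ (x : Site d) (μ : Fin d), x ≠ x₀ → A x μ = 0) (hcomm : ∀ (μ ν : Fin d), Commute (A x₀ μ) (A x₀ ν)) :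
    ‖CCovIter2 L U₀ A j z κ‖ ≤ 4 * (L : ℝ) ^ j * a ^ 2 * ((4 * d * (L : ℝ) ^ j + 1) * α) / (β * β') := by
  have h := norm_remainder_curvature_le_of_plaq_oneSite L hL hG k hα hα3 hα8 hβ hβ' hsmall' hc₃' hb'1 hsmall hc₃ ha0 ha U₀ hU₀ h52 hj z κ
    h52loc hαp h44 hαs hbβ x₀ hsupp hcomm
  have h2 : ‖(2 : ℂ)⁻¹‖ = 2⁻¹ := by simp
  rw [CCovIter2_def, norm_smul, h2]
  have h0 : 0 ≤ ‖iteratedDeriv 2 (fun t : ℂ => CCovIter L U₀ (t • A) j z κ) 0‖ := norm_nonneg _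
  calc 2⁻¹ * ‖iteratedDeriv 2 (fun t : ℂ => CCovIter L U₀ (t • A) j z κ) 0‖
      ≤ 2⁻¹ * (8 * (L : ℝ) ^ j * a ^ 2 * ((4 * d * (L : ℝ) ^ j + 1) * α) / (β * β')) := by gcongr
    _ = 4 * (L : ℝ) ^ j * a ^ 2 * ((4 * d * (L : ℝ) ^ j + 1) * α) / (β * β') := by ring

end Bounds

end Summit.QuantumFields.BalabanUV.T4Continuum.NE1p.B7AveragingCommutator

end
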